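import Summits.QuantumFields.YangMills.Theorems.BalabanUVNodesN15KingModelPotentialSiteSizeOnly

/-!
# N15 (NE2⁺), King-model rung, part 25: the node's K4 face `N15At` FAILS on the dressed carriers whose background sort reads SIZE ONLY

Cell `pub-ymgap-dag-n15-d` (R134 acceleration DAG, node N15 = NE2, strategy s3 KING-MODEL RUNG), part 25.  Part 16 (`…PotentialDressedOperator`)
assembled the dressed King carriers `kingCarriersSC` on part 15's size-AND-coherence sort and proved `n15At_kingModelSC : N15At (kingCarriersSC d L a m² s c₃₅ p)`
— all three NE2⁺ layers BY NAME with a live, populated background sort.  THIS FILE builds the SAME carriers on part 8c's sort `potBg` (whose (3.35) slot is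
SIZE ONLY) — `kingCarriersV`: index `KingPotIdx d × Fin (d+1)`, families `kingInstanceVν`, operator slot `kingOpV` (the four (3.42) entries of the dressed
covariance difference, as part 16's `kingOpSC`), site slot `kingHSiteV` (part 15), unit slot `kingKerVW` (part 10d) — and proves

  ★★ `not_n15At_kingModelV : ¬ N15At (kingCarriersV d L a m² s c₃₅ p)`,

because the SITE conjunct fails (part 21 `not_ne2PlusSite_kingHV`, restricted along the direction index).  So the node's by-name statement `N15At`
DISCRIMINATES the two readings of [B9]'s regularity slots in King's model: it holds on the size-and-coherence carriers (part 16) and fails on the size-only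
carriers (here) — the slot question of parts 15∕19b∕21–24 read at the K4 face.  The unit conjunct alone still holds on these carriers (part 10d
`ne2PlusUnit_kingVW`, which reads the coherence slot (3.36)); nothing is claimed about the operator conjunct.

HONEST SCOPE.  King's A = 0 scalar model on the King-admissible tori `Π ℤ∕(2L^{e+1})`, odd `L ≥ 3`, `a, m² > 0`, `c₃₅ > 0`; scalar potentials (NOT gauge
fields); OUR slot readings; NOT Bałaban's carriers of record (NODE 00), not `H_k(U)` ∕ `C^{(k)}(Λ;U)`; count-neutral (`--supports`), not a discharge of N15,
nothing in `YMDAG.*` written (only `NE2Carriers` ∕ `N15At` READ); standard axioms.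

References: [B9] = Bałaban, Commun. Math. Phys. 102 (1985) 385–462, (3.35)–(3.36) p.396, Thm 3.1 (3.42) p.397, (3.133) p.422, Thm 3.14 pp.426–427,
Thm 3.15 p.432 (templates) (bib key `Balaban1985BackgroundPropagators`); C. King, Commun. Math. Phys. 102 (1986) 649–677, Prop. 3.8 (3.71) p.664,
Lemma 4.5 (4.38) p.674 (A = 0 model) (bib key `King1986`).
-/

noncomputable section
open scoped BigOperators

namespace Summit.QuantumFields.YangMills.BalabanUVNodes.N15.KingModel

open Literature.MathematicalPhysics.QuantumFieldTheory.Balaban1983to89 hiding blockOf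
open Literature.MathematicalPhysics.QuantumFieldTheory.Balaban1983to89.T4EtaRate (PairedInstance NE2PlusSite NE2PlusUnit)
open Literature.MathematicalPhysics.QuantumFieldTheory.Balaban1983to89.B5Prop11Plancherel (Tor fine)
open Summit.QuantumFields.YangMills.BalabanUVNodes.N15.OperatorReadout (opGeo opFamily)
open YMDAG.UVSplit (NE2Carriers N15At)

variable {d : ℕ}

/-! ## §1 The dressed carriers on the size-only sort -/

section Carriers

variable (L : ℕ) [NeZero L]

/-- THE DRESSED KING FAMILY WITH A DIRECTION on part 8c's sort: index `(i, ν)`, instance `kingInstanceV i` (size in (3.35), coherence in (3.36)).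
[cite: Balaban1985BackgroundPropagators, Thm 3.1 p.397 + Thm 3.14 pp.426–427 (typing template)] -/
def kingInstanceVν (s : ℝ) (j : KingPotIdx d × Fin (d + 1)) : PairedInstance := kingInstanceV L s j.1

/-- THE FOUR DRESSED ENTRY OPERATORS at index `(i, ν)` and tower `v` on part 8c's sort (part 16's `torOps` of the dressed kernel matrix `kingKerMat`).
[cite: Balaban1985BackgroundPropagators, (3.42) p.397 (the four entries: shape)] -/
def kingOpsV (a m2 s : ℝ) (j : KingPotIdx d × Fin (d + 1)) :
    Fin 4 → (potBg L s (kingU d L j.1.e)).Cfg → ((Tor (kingU d L j.1.e) → ℝ) →ₗ[ℝ] (Tor (kingU d L j.1.e) → ℝ)) :=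
  fun m v => torOps (kingU d L j.1.e) (kingKerMat L a m2 s j.1 v) j.2 m

/-- THE DRESSED OPERATOR-LAYER KERNEL FAMILY on part 8c's sort (n15-b's `opFamily`, every site its own block; as part 16's `kingOpSC`).
[cite: Balaban1985BackgroundPropagators, (3.42) p.397 (the four sup entries: shape)] -/
def kingOpV (a m2 s : ℝ) (j : KingPotIdx d × Fin (d + 1)) : B9.KernelFamily (kingInstanceVν L s j).gc (kingInstanceVν L s j).Bf :=
  show B9.KernelFamily (kingGeoCV L j.1) (potBg L s (kingU d L j.1.e)) from
    opFamily (g := kingGeo L j.1.k (kingU d L j.1.e) j.1.Msz) (fun x => x) (fun x => x) (kingOpsV L a m2 s j)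

end Carriers

/-- **THE DRESSED KING CARRIERS OF NODE N15 ON THE SIZE-ONLY SORT** (`YMDAG.UVSplit.NE2Carriers`): part 16's `kingCarriersSC` with part 8c's sort `potBg`
in place of `potBgSC` — index `KingPotIdx d × Fin (d+1)`, operator slot `kingOpV`, site slot part 15's `kingHSiteV`, unit slot part 10d's `kingKerVW`,
`inΛ := True`, `unitDist := tdistT`; `c₃₅`, `p` free. [cite: King1986, Prop. 3.8 (3.71) p.664 + Lemma 4.5 (4.38) p.674 (the objects, A = 0); Balaban1985BackgroundPropagators, Thm 3.1 p.397 + Thm 3.14 pp.426–427 + Thm 3.15 p.432 (shapes)] -/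
def kingCarriersV (d L : ℕ) [NeZero L] (a m2 s c35 p : ℝ) : NE2Carriers where
  I := KingPotIdx d × Fin (d + 1)
  c35 := c35
  p := p
  pi := kingInstanceVν (d := d) L s
  Kop := kingOpV L a m2 s
  Ksite := fun j => kingHSiteV L a m2 s j.1
  Kunit := fun j => kingKerVW L a m2 s j.1
  inΛ := fun _ _ => True
  unitDist := fun j => kingDistV L s j.1

/-! ## §2 `N15At` fails on the size-only carriers -/

/-- **`N15At` FAILS ON THE DRESSED KING CARRIERS WHOSE BACKGROUND SORT READS SIZE ONLY** (every torus dimension `d + 1`, odd `L ≥ 3`, `a, m² > 0`,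
`c₃₅ > 0`, every `s`, `p`): its SITE conjunct `NE2PlusSite 4 p c₃₅ _ (kingHSiteV ∘ fst)` restricts along the direction index to
`NE2PlusSite 4 p c₃₅ (kingInstanceV L s) (kingHSiteV L a m² s)`, refuted by part 21 `not_ne2PlusSite_kingHV`.  CONTRAST: `N15At (kingCarriersSC …)` HOLDS
(part 16 `n15At_kingModelSC`); on the present carriers the unit conjunct alone still holds (part 10d `ne2PlusUnit_kingVW`).  NOT Bałaban's carriers of
record; NOT a node discharge; count-neutral. [cite: Balaban1985BackgroundPropagators, (3.35)–(3.36) p.396 + Thm 3.14 pp.426–427 (quantifier template); King1986, Prop. 3.8 (3.71) p.664 (A = 0 model)] -/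
theorem not_n15At_kingModelV (d : ℕ) {L : ℕ} [NeZero L] (hLodd : Odd L) (hL : 2 ≤ L) {a m2 : ℝ} (ha : 0 < a) (hm : 0 < m2)
    {c35 : ℝ} (hc : 0 < c35) (s p : ℝ) : ¬ N15At (kingCarriersV d L a m2 s c35 p) := by
  rintro ⟨-, ⟨M₅, δ, a₀, C, γ, hM, hδ, ha₀, hC, hγ, H⟩, -⟩
  exact not_ne2PlusSite_kingHV (d := d) L hLodd hL ha hm hc s 4 p
    ⟨M₅, δ, a₀, C, γ, hM, hδ, ha₀, hC, hγ, fun i hMi α₀ hα hMa v h335 => H (i, 0) hMi α₀ hα hMa v h335⟩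

/-- **THE FOUR-TORUS INSTANCE** (`d + 1 = 4`). [cite: King1986, Prop. 3.8 (3.71) p.664 (A = 0 model)] -/
theorem not_n15At_kingModelV_dim4 {L : ℕ} [NeZero L] (hLodd : Odd L) (hL : 2 ≤ L) {a m2 : ℝ} (ha : 0 < a) (hm : 0 < m2) {c35 : ℝ}
    (hc : 0 < c35) (s p : ℝ) : ¬ N15At (kingCarriersV 3 L a m2 s c35 p) :=
  not_n15At_kingModelV 3 hLodd hL ha hm hc s p

/-- The unit conjunct of `N15At` DOES hold on the size-only carriers (part 10d: `NE2PlusUnit` reads the coherence slot (3.36)), so the failure is the site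
layer's. [cite: Balaban1985BackgroundPropagators, Thm 3.15 (3.187) p.432 (quantifier template); King1986, Lemma 4.5 (4.38) p.674 (A = 0 model)] -/
theorem ne2PlusUnit_kingCarriersV (d : ℕ) {L : ℕ} [NeZero L] (hLodd : Odd L) (hL : 2 ≤ L) {a m2 : ℝ} (ha : 0 < a) (hm : 0 < m2)
    {c35 : ℝ} (hc : 0 < c35) {s : ℝ} (hs0 : 0 ≤ s) (hs1 : s ≤ (L : ℝ) ^ (-(1 / 2 : ℝ))) (p : ℝ) :
    NE2PlusUnit (kingCarriersV d L a m2 s c35 p).c35 (kingCarriersV d L a m2 s c35 p).pi (kingCarriersV d L a m2 s c35 p).Kunit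
      (kingCarriersV d L a m2 s c35 p).inΛ (kingCarriersV d L a m2 s c35 p).unitDist := by
  obtain ⟨δ₀, a₀, B₀, θ, hδ, ha₀, hB, hθ0, hθ1, H⟩ := ne2PlusUnit_kingVW (d := d) L hLodd hL ha hm hc hs0 hs1
  exact ⟨δ₀, a₀, B₀, θ, hδ, ha₀, hB, hθ0, hθ1, fun j => H j.1⟩

/-- NON-VACUITY OF THE INDEX BLOCK. [folklore] -/
theorem kingCarriersV_index_nonempty (d L : ℕ) [NeZero L] (a m2 s c35 p : ℝ) : Nonempty (kingCarriersV d L a m2 s c35 p).I :=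
  ⟨(⟨0, 1, le_rfl, 1, le_rfl, 1, le_rfl⟩, 0)⟩

/-- NON-VACUITY OF THE BACKGROUND WINDOW: the block lift of every unit-lattice field of sup `≤ c₃₅α₀` is in the (3.35)-window of the size-only carriers at
every index (`s ≥ 0`). [folklore] -/
theorem kingCarriersV_window_populated {L : ℕ} [NeZero L] (a m2 : ℝ) {s : ℝ} (hs : 0 ≤ s) (c35 p : ℝ)
    (j : KingPotIdx d × Fin (d + 1)) (α₀ : ℝ) (W : Tor (kingU d L j.1.e) → ℝ) (hW : ∀ z, |W z| ≤ c35 * α₀) :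
    ((kingCarriersV d L a m2 s c35 p).pi j).Bf.Reg335 c35 α₀ (blockLift (kingU d L j.1.e) W) :=
  (potBg_reg_blockLift (d := d) L hs (kingU d L j.1.e) W hW).1

end Summit.QuantumFields.YangMills.BalabanUVNodes.N15.KingModel

end
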